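import Mathlib.Analysis.Complex.JensenFormula
import Mathlib.Analysis.SpecialFunctions.Integrals.PosLogEqCircleAverage
import Mathlib.Analysis.Complex.Harmonic.MeanValue
import Mathlib.Analysis.InnerProductSpace.Harmonic.Constructions
import Mathlib.Analysis.Analytic.IsolatedZeros
import Mathlib.Analysis.Calculus.DSlope
import Mathlib.Tactic
import HarnessLib

/-!
# The Bost–Charles double integral of a univalent map equals its conformal size

In the proof of the *univalent holonomy bound* [CalegariDimitrovTang2024, §2.7 Theorem 12
(p. 13)], Calegari–Dimitrov–Tang observe that the Bost–Charles double integral of a holomorphic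
map `φ : 𝔻 → ℂ` dominates its conformal size,
`∬_{𝕋²} log|φ(z) − φ(w)| μ(z)μ(w) ≥ log|φ'(0)|`,
*with equality if (and only if) `φ` is univalent*: the function
`G(z,w) = log|(φ(z) − φ(w))/(z − w)|` is plurisubharmonic, harmonic iff `φ` is univalent,
`G(0,0) = log|φ'(0)|`, and `∬_{𝕋²} log|z − w| = 0`.

This file proves the **equality for univalent `φ`** (`bcIntegral_eq_log_norm_deriv`): for `φ`
analytic on a neighbourhood of the closed unit disc with non-vanishing difference quotients
`(φ(z) − φ(w))/(z − w)` (`z ≠ w`) and `φ' ≠ 0` there — i.e. univalent on a neighbourhood of the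
closed disc, cf. `bcIntegral_eq_log_norm_deriv_of_injOn` — the iterated circle average
`⨍_{|z|=1} ⨍_{|w|=1} log|φ(z) − φ(w)|` equals `log|φ'(0)|`. The proof is the printed one, with
Mathlib's mean value property of harmonic functions (`HarmonicOnNhd.circleAverage_eq`),
`AnalyticAt.harmonicAt_log_norm` for `w ↦ dslope φ z w`, and
`circleAverage_log_norm_sub_const₁` (`⨍_{|w|=1} log|w − z| = 0` for `|z| = 1`).
We also record the one-variable half of the inequality direction
(`log_norm_sub_apply_zero_le_circleAverage`, by Jensen's formula): for `|z| = 1` with `φ(z) ≠ φ(0)`,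
`⨍_{|w|=1} log|φ(z) − φ(w)| ≥ log|φ(z) − φ(0)|`.
The inequality direction for general (non-univalent) `φ` with `φ'(0) ≠ 0` is
`log_norm_deriv_le_bcIntegral`, under the circle-integrability in `z` of the inner average
(a hypothesis forced by the junk value of `circleAverage`); TODO(only-if): the "only if" of the
equality case is not formalized here.

## References
* [CalegariDimitrovTang2024] F. Calegari, V. Dimitrov, Y. Tang, *The linear independence of 1,
  ζ(2) and L(2, χ₋₃)*, arXiv:2408.15403 (2024), §2.7, proof of Theorem 12 (p. 13).
-/

namespace Literature.NumberTheory.Transcendental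

namespace HolonomyBound

open Metric Real Complex Set Filter InnerProductSpace

noncomputable section

/-- The **Bost–Charles double integral** `∬_{𝕋²} log|φ(z) − φ(w)| μ(z) μ(w)` of a map `φ`,
as an iterated circle average over the unit torus. (Mathlib's `circleAverage` is `0` on
non-circle-integrable integrands, so inequalities for `bcIntegral` carry the integrability of the
inner average as a hypothesis, cf. `log_norm_deriv_le_bcIntegral`.)
[cite: CalegariDimitrovTang2024, §2.5 Theorem 9 eq. (new bound); §2.7 proof of Theorem 12] -/
def bcIntegral (φ : ℂ → ℂ) : ℝ :=
  circleAverage (fun z => circleAverage (fun w => Real.log ‖φ z - φ w‖) 0 1) 0 1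

variable {φ : ℂ → ℂ}

/-- `dslope` is symmetric: `(φ(b) − φ(a))/(b − a) = (φ(a) − φ(b))/(a − b)` (and `φ'(a)` on the
diagonal). [folklore] -/
theorem dslope_comm (φ : ℂ → ℂ) (a b : ℂ) : dslope φ a b = dslope φ b a := by
  rcases eq_or_ne b a with rfl | h
  · rfl
  · rw [dslope_of_ne φ h, dslope_of_ne φ h.symm, slope_comm]

/-- For `φ` analytic on a neighbourhood of the closed disc, each difference quotient
`w ↦ dslope φ z w` (`|z| ≤ 1`) is analytic there. [folklore] -/
theorem analyticOnNhd_dslope (hφ : AnalyticOnNhd ℂ φ (closedBall (0 : ℂ) 1)) {z : ℂ}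
    (hz : z ∈ closedBall (0 : ℂ) 1) : AnalyticOnNhd ℂ (dslope φ z) (closedBall (0 : ℂ) 1) := by
  intro w hw
  rcases eq_or_ne w z with rfl | hwz
  · obtain ⟨p, hp⟩ := hφ w hw
    exact ⟨_, hp.has_fpower_series_dslope_fslope⟩
  · have heq : dslope φ z =ᶠ[nhds w] slope φ z := dslope_eventuallyEq_slope_of_ne φ hwz
    refine AnalyticAt.congr ?_ heq.symm
    have h1 : AnalyticAt ℂ (fun w => (w - z)⁻¹) w :=
      ((analyticAt_id.sub analyticAt_const).inv (sub_ne_zero.mpr hwz))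
    have h2 : AnalyticAt ℂ (fun w => φ w - φ z) w := (hφ w hw).sub analyticAt_const
    have : slope φ z = fun w => (w - z)⁻¹ • (φ w - φ z) := by
      funext w; rfl
    rw [this]
    exact h1.smul h2

/-- Mean value step in `w`: if `w ↦ dslope φ z w` does not vanish on the closed disc, then
`⨍_{|w|=1} log|φ(z) − φ(w)| = log|(φ(z) − φ(0))/z|` for `|z| = 1`.
[cite: CalegariDimitrovTang2024, §2.7 proof of Theorem 12] -/
theorem circleAverage_log_norm_sub_eq (hφ : AnalyticOnNhd ℂ φ (closedBall (0 : ℂ) 1)) {z : ℂ}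
    (hz : ‖z‖ = 1) (hQ : ∀ w ∈ closedBall (0 : ℂ) 1, dslope φ z w ≠ 0) :
    circleAverage (fun w => Real.log ‖φ z - φ w‖) 0 1 = Real.log ‖dslope φ z 0‖ := by
  have hzCB : z ∈ closedBall (0 : ℂ) 1 := by simpa using hz.le
  have hQan := analyticOnNhd_dslope hφ hzCB
  -- `log|φ z − φ w| = log|dslope φ z w| + log|w − z|` off `w = z`
  have hcod : (fun w => Real.log ‖φ z - φ w‖) =ᶠ[codiscreteWithin (sphere (0 : ℂ) |1|)]
      (fun w => Real.log ‖dslope φ z w‖ + Real.log ‖w - z‖) := by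
    have hmem : ({z} : Set ℂ)ᶜ ∈ codiscreteWithin (sphere (0 : ℂ) |1|) :=
      compl_finite_mem_codiscreteWithin (Set.finite_singleton z)
    filter_upwards [hmem, Filter.self_mem_codiscreteWithin (sphere (0 : ℂ) |1|)] with w hw hwS
    have hwz : w ≠ z := fun h => hw h
    have hwCB : w ∈ closedBall (0 : ℂ) 1 := sphere_subset_closedBall (by rwa [abs_one] at hwS)
    have hsub : φ z - φ w = -((w - z) • dslope φ z w) := by rw [sub_smul_dslope]; ring
    rw [hsub, norm_neg, norm_smul, mul_comm, Real.log_mul (norm_ne_zero_iff.mpr (hQ w hwCB))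
      (norm_ne_zero_iff.mpr (sub_ne_zero.mpr hwz))]
  rw [circleAverage_congr_codiscreteWithin hcod one_ne_zero]
  have hi1 : CircleIntegrable (fun w => Real.log ‖dslope φ z w‖) 0 1 := by
    apply ContinuousOn.circleIntegrable zero_le_one
    refine ContinuousOn.log ?_ fun w hw => norm_ne_zero_iff.mpr (hQ w (sphere_subset_closedBall hw))
    exact (hQan.continuousOn.mono sphere_subset_closedBall).norm
  have hi2 : CircleIntegrable (fun w => Real.log ‖w - z‖) 0 1 := circleIntegrable_log_norm_sub_const 1
  rw [show (fun w => Real.log ‖dslope φ z w‖ + Real.log ‖w - z‖) =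
      (fun w => Real.log ‖dslope φ z w‖) + (fun w => Real.log ‖w - z‖) from rfl,
    circleAverage_add hi1 hi2, circleAverage_log_norm_sub_const₁ hz, add_zero]
  -- mean value property for the harmonic function `log|dslope φ z ·|`
  have hharm : HarmonicOnNhd (fun w => Real.log ‖dslope φ z w‖) (closedBall (0 : ℂ) |1|) := by
    intro w hw
    rw [abs_one] at hw
    exact (hQan w hw).harmonicAt_log_norm (hQ w hw)
  exact HarmonicOnNhd.circleAverage_eq hharm

/-- **The Bost–Charles integral of a univalent map is its conformal size** (equality case in the
proof of CDT Theorem 12): if `φ` is analytic on a neighbourhood of the closed unit disc and all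
difference quotients `dslope φ z w` (`|z|,|w| ≤ 1`; this is `(φ(w) − φ(z))/(w − z)` for `w ≠ z`
and `φ'(z)` for `w = z`) are non-zero, then
`⨍_{|z|=1} ⨍_{|w|=1} log|φ(z) − φ(w)| = log|φ'(0)|`.
[cite: CalegariDimitrovTang2024, §2.7 proof of Theorem 12 (p. 13)] -/
theorem bcIntegral_eq_log_norm_deriv (hφ : AnalyticOnNhd ℂ φ (closedBall (0 : ℂ) 1))
    (hQ : ∀ z ∈ closedBall (0 : ℂ) 1, ∀ w ∈ closedBall (0 : ℂ) 1, dslope φ z w ≠ 0) :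
    bcIntegral φ = Real.log ‖deriv φ 0‖ := by
  unfold bcIntegral
  have h0 : (0 : ℂ) ∈ closedBall (0 : ℂ) 1 := by simp
  -- inner averages
  have hinner : Set.EqOn (fun z => circleAverage (fun w => Real.log ‖φ z - φ w‖) 0 1)
      (fun z => Real.log ‖dslope φ 0 z‖) (sphere (0 : ℂ) |1|) := by
    intro z hz
    rw [abs_one] at hz
    have hz' : ‖z‖ = 1 := by simpa using hz
    simp only
    rw [circleAverage_log_norm_sub_eq hφ hz' (hQ z (sphere_subset_closedBall hz)), dslope_comm]
  rw [circleAverage_congr_sphere hinner]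
  -- outer average: mean value for `log|dslope φ 0 ·|`
  have hQan := analyticOnNhd_dslope hφ h0
  have hharm : HarmonicOnNhd (fun z => Real.log ‖dslope φ 0 z‖) (closedBall (0 : ℂ) |1|) := by
    intro z hz
    rw [abs_one] at hz
    exact (hQan z hz).harmonicAt_log_norm (hQ 0 h0 z hz)
  rw [HarmonicOnNhd.circleAverage_eq hharm, dslope_same]

/-- Univalence on the closed disc in the usual form (injective, `φ' ≠ 0`) gives the
non-vanishing of all difference quotients. [folklore] -/
theorem dslope_ne_zero_of_injOn (hinj : Set.InjOn φ (closedBall (0 : ℂ) 1))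
    (hder : ∀ z ∈ closedBall (0 : ℂ) 1, deriv φ z ≠ 0) :
    ∀ z ∈ closedBall (0 : ℂ) 1, ∀ w ∈ closedBall (0 : ℂ) 1, dslope φ z w ≠ 0 := by
  intro z hz w hw
  rcases eq_or_ne w z with rfl | hwz
  · rw [dslope_same]; exact hder w hw
  · rw [dslope_of_ne φ hwz, slope_def_module]
    refine smul_ne_zero (inv_ne_zero (sub_ne_zero.mpr hwz)) (sub_ne_zero.mpr ?_)
    exact fun h => hwz (hinj hw hz h)

/-- **The Bost–Charles integral of a univalent map**, injective form: for `φ` analytic,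
injective and with `φ' ≠ 0` on a neighbourhood of the closed unit disc,
`⨍_{|z|=1} ⨍_{|w|=1} log|φ(z) − φ(w)| = log|φ'(0)|`.
[cite: CalegariDimitrovTang2024, §2.7 proof of Theorem 12 (p. 13)] -/
theorem bcIntegral_eq_log_norm_deriv_of_injOn (hφ : AnalyticOnNhd ℂ φ (closedBall (0 : ℂ) 1))
    (hinj : Set.InjOn φ (closedBall (0 : ℂ) 1)) (hder : ∀ z ∈ closedBall (0 : ℂ) 1, deriv φ z ≠ 0) :
    bcIntegral φ = Real.log ‖deriv φ 0‖ :=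
  bcIntegral_eq_log_norm_deriv hφ (dslope_ne_zero_of_injOn hinj hder)

/-- One-variable half of the inequality direction (Jensen): for `φ` analytic on a neighbourhood
of the closed unit disc and `|z| = 1` with `φ(z) ≠ φ(0)`,
`log|φ(z) − φ(0)| ≤ ⨍_{|w|=1} log|φ(z) − φ(w)|` (the sub-mean-value property of the
subharmonic `w ↦ log|φ(z) − φ(w)|` at `w = 0`).
[cite: CalegariDimitrovTang2024, §2.7 proof of Theorem 12 ("`G` is plurisubharmonic")] -/
theorem log_norm_sub_apply_zero_le_circleAverage (hφ : AnalyticOnNhd ℂ φ (closedBall (0 : ℂ) 1)) {z : ℂ}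
    (hz0 : φ z ≠ φ 0) :
    Real.log ‖φ z - φ 0‖ ≤ circleAverage (fun w => Real.log ‖φ z - φ w‖) 0 1 := by
  set g : ℂ → ℂ := fun w => φ z - φ w with hg
  have hgan : AnalyticOnNhd ℂ g (closedBall (0 : ℂ) |1|) := by
    intro w hw
    rw [abs_one] at hw
    exact analyticAt_const.sub (hφ w hw)
  have hg0 : g 0 ≠ 0 := sub_ne_zero.mpr hz0
  have hJ := hgan.circleAverage_log_norm one_ne_zero hg0
  change circleAverage (fun w => Real.log ‖g w‖) 0 1 = _ at hJ
  change Real.log ‖g 0‖ ≤ circleAverage (fun w => Real.log ‖g w‖) 0 1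
  rw [hJ, le_add_iff_nonneg_left]
  refine finsum_nonneg fun u => ?_
  by_cases hu : u ∈ closedBall (0 : ℂ) |1|
  · refine mul_nonneg ?_ ?_
    · exact_mod_cast MeromorphicOn.AnalyticOnNhd.divisor_nonneg hgan u
    · rw [zero_sub, norm_neg, one_mul]
      rcases eq_or_ne u 0 with rfl | hu0
      · simp
      · refine Real.log_nonneg ?_
        rw [abs_one, mem_closedBall, dist_zero_right] at hu
        exact one_le_inv_iff₀.mpr ⟨norm_pos_iff.mpr hu0, hu⟩
  · rw [Function.locallyFinsuppWithin.apply_eq_zero_of_notMem _ hu]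
    simp

open MeasureTheory

/-! ### The inequality `∬ log|φ(z) − φ(w)| ≥ log|φ'(0)|` for general `φ`

The inequality direction of [CalegariDimitrovTang2024, §2.7 proof of Theorem 12] for `φ`
analytic on a neighbourhood of the closed unit disc with `φ'(0) ≠ 0` (not necessarily
univalent): by Jensen's formula in `w` (`log_norm_sub_apply_zero_le_circleAverage`) the inner
average dominates `log|φ(z) − φ(0)|` off the finite set of `z ∈ 𝕋` with `φ(z) = φ(0)`, and by
Jensen's formula in `z` the average of `log|φ(z) − φ(0)| = log|(φ(z) − φ(0))/z|` (`|z| = 1`)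
dominates `log|φ'(0)|`. Because Mathlib's `circleAverage` returns the junk value `0` for a
non-circle-integrable integrand, the Lean statement carries the circle-integrability of the inner
average `z ↦ ⨍_{|w|=1} log|φ(z) − φ(w)|` as a hypothesis (it holds whenever the double integral
exists, e.g. for `φ` univalent, where `bcIntegral_eq_log_norm_deriv` gives equality). -/

/-- `⨍_{|z|=1} log|φ(z) − φ(0)| ≥ log|φ'(0)|` for `φ` analytic on a neighbourhood of the closed
unit disc with `φ'(0) ≠ 0` (Jensen for `z ↦ (φ(z) − φ(0))/z`, whose modulus agrees with
`|φ(z) − φ(0)|` on the unit circle). [cite: CalegariDimitrovTang2024, §2.7 proof of Theorem 12] -/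
theorem log_norm_deriv_le_circleAverage_log_norm_sub (hφ : AnalyticOnNhd ℂ φ (closedBall (0 : ℂ) 1))
    (hd : deriv φ 0 ≠ 0) :
    Real.log ‖deriv φ 0‖ ≤ circleAverage (fun z => Real.log ‖φ z - φ 0‖) 0 1 := by
  have h0 : (0 : ℂ) ∈ closedBall (0 : ℂ) 1 := by simp
  have hQan := analyticOnNhd_dslope hφ h0
  -- on the unit circle `|φ z − φ 0| = |dslope φ 0 z|`
  have hsph : Set.EqOn (fun z => Real.log ‖φ z - φ 0‖) (fun z => Real.log ‖dslope φ 0 z‖)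
      (sphere (0 : ℂ) |1|) := by
    intro z hz
    rw [abs_one] at hz
    have hz' : ‖z‖ = 1 := by simpa using hz
    simp only
    rw [← sub_smul_dslope φ 0 z, sub_zero, norm_smul, hz', one_mul]
  rw [circleAverage_congr_sphere hsph]
  have hQan' : AnalyticOnNhd ℂ (dslope φ 0) (closedBall (0 : ℂ) |1|) := by rwa [abs_one]
  have hQ0 : dslope φ 0 0 ≠ 0 := by rwa [dslope_same]
  have hJ := hQan'.circleAverage_log_norm one_ne_zero hQ0
  rw [hJ, dslope_same, le_add_iff_nonneg_left]
  refine finsum_nonneg fun u => ?_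
  by_cases hu : u ∈ closedBall (0 : ℂ) |1|
  · refine mul_nonneg ?_ ?_
    · exact_mod_cast MeromorphicOn.AnalyticOnNhd.divisor_nonneg hQan' u
    · rw [zero_sub, norm_neg, one_mul]
      rcases eq_or_ne u 0 with rfl | hu0
      · simp
      · refine Real.log_nonneg ?_
        rw [abs_one, mem_closedBall, dist_zero_right] at hu
        exact one_le_inv_iff₀.mpr ⟨norm_pos_iff.mpr hu0, hu⟩
  · rw [Function.locallyFinsuppWithin.apply_eq_zero_of_notMem _ hu]
    simp

/-- Off a finite subset of the unit circle, `φ(z) ≠ φ(0)`: the complement of the zero set of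
`z ↦ φ(z) − φ(0)` is codiscrete within the closed disc when `φ'(0) ≠ 0`. [folklore] -/
theorem codiscreteWithin_ne_apply_zero (hφ : AnalyticOnNhd ℂ φ (closedBall (0 : ℂ) 1))
    (hd : deriv φ 0 ≠ 0) :
    {z : ℂ | φ z ≠ φ 0} ∈ codiscreteWithin (closedBall (0 : ℂ) 1) := by
  set g : ℂ → ℂ := fun z => φ z - φ 0 with hg
  have hgan : AnalyticOnNhd ℂ g (closedBall (0 : ℂ) 1) := fun z hz => (hφ z hz).sub analyticAt_const
  have h0 : (0 : ℂ) ∈ closedBall (0 : ℂ) 1 := by simp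
  -- `g` is not locally zero at `0` (its derivative there is `φ'(0) ≠ 0`)
  have hg0 : analyticOrderAt g 0 ≠ ⊤ := by
    intro htop
    rw [analyticOrderAt_eq_top] at htop
    have hderiv : deriv g 0 = deriv (fun _ : ℂ => (0 : ℂ)) 0 := Filter.EventuallyEq.deriv_eq htop
    rw [deriv_const] at hderiv
    have : deriv g 0 = deriv φ 0 := by
      rw [hg]; exact deriv_sub_const (φ 0)
    exact hd (this ▸ hderiv)
  have hne : ∀ z ∈ closedBall (0 : ℂ) 1, analyticOrderAt g z ≠ ⊤ := fun z hz =>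
    hgan.analyticOrderAt_ne_top_of_isPreconnected (convex_closedBall (0 : ℂ) 1).isPreconnected h0 hz hg0
  have hcod := hgan.codiscreteWithin_setOf_analyticOrderAt_eq_zero_or_top
  -- intersect with the set itself to use `hne`
  have hself : closedBall (0 : ℂ) 1 ∈ codiscreteWithin (closedBall (0 : ℂ) 1) :=
    Filter.self_mem_codiscreteWithin _
  filter_upwards [hcod, hself] with z hz hzCB
  rcases hz with h | h
  · rw [(hgan z hzCB).analyticOrderAt_eq_zero] at h
    exact sub_ne_zero.mp h
  · exact absurd h (hne z hzCB)

/-- **`∬_{𝕋²} log|φ(z) − φ(w)| ≥ log|φ'(0)|`** (the inequality direction in the proof of CDT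
Theorem 12), for `φ` analytic on a neighbourhood of the closed unit disc with `φ'(0) ≠ 0`, under
the circle-integrability of the inner average `z ↦ ⨍_{|w|=1} log|φ(z) − φ(w)|` (needed to give
the outer Lean `circleAverage` its meaning). [cite: CalegariDimitrovTang2024, §2.7 proof of
Theorem 12 (p. 13)] -/
theorem log_norm_deriv_le_bcIntegral (hφ : AnalyticOnNhd ℂ φ (closedBall (0 : ℂ) 1))
    (hd : deriv φ 0 ≠ 0)
    (hint : CircleIntegrable (fun z => circleAverage (fun w => Real.log ‖φ z - φ w‖) 0 1) 0 1) :
    Real.log ‖deriv φ 0‖ ≤ bcIntegral φ := by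
  refine (log_norm_deriv_le_circleAverage_log_norm_sub hφ hd).trans ?_
  unfold bcIntegral
  set F : ℂ → ℝ := fun z => circleAverage (fun w => Real.log ‖φ z - φ w‖) 0 1 with hF
  set G : ℂ → ℝ := fun z => Real.log ‖φ z - φ 0‖ with hG
  -- `G ≤ F` off the finite exceptional set, hence a.e. on the circle
  have hcodCB : {z : ℂ | φ z ≠ φ 0} ∈ codiscreteWithin (sphere (0 : ℂ) |1|) := by
    refine Filter.codiscreteWithin_mono ?_ (codiscreteWithin_ne_apply_zero hφ hd)
    rw [abs_one]; exact sphere_subset_closedBall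
  have hev : ∀ᶠ z in codiscreteWithin (sphere (0 : ℂ) |1|), G z ≤ F z := by
    filter_upwards [hcodCB] with z hz
    exact log_norm_sub_apply_zero_le_circleAverage hφ hz
  -- transport to an a.e. statement in the angle `θ`
  have hae : ∀ᵐ θ ∂(volume.restrict (Set.uIoc 0 (2 * π))), G (circleMap 0 1 θ) ≤ F (circleMap 0 1 θ) := by
    have h1 : (circleMap 0 1) ⁻¹' {z | G z ≤ F z} ∈ codiscreteWithin (Set.univ : Set ℝ) :=
      circleMap_preimage_codiscrete (c := 0) (R := 1) one_ne_zero hev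
    have h2 : (circleMap 0 1) ⁻¹' {z | G z ≤ F z} ∈ codiscreteWithin (Set.uIoc 0 (2 * π)) :=
      Filter.codiscreteWithin_mono (Set.subset_univ _) h1
    exact ae_restrict_le_codiscreteWithin measurableSet_uIoc h2
  -- integrability of both sides along the circle
  have hGint : CircleIntegrable G 0 1 := by
    have hgan : AnalyticOnNhd ℂ (fun z => φ z - φ 0) (sphere (0 : ℂ) |1|) := fun z hz =>
      (hφ z (sphere_subset_closedBall (by rwa [abs_one] at hz))).sub analyticAt_const
    exact hgan.meromorphicOn.circleIntegrable_log_norm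
  rw [circleAverage_def, circleAverage_def]
  refine smul_le_smul_of_nonneg_left ?_ (by positivity)
  have h2π : (0 : ℝ) ≤ 2 * π := by positivity
  refine intervalIntegral.integral_mono_ae_restrict h2π hGint hint ?_
  rw [Measure.restrict_congr_set Ioc_ae_eq_Icc.symm, ← uIoc_of_le h2π]
  exact hae

end

end HolonomyBound

end Literature.NumberTheory.Transcendental
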